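import Literature.MathematicalPhysics.QuantumLattice.Imbrie2016.ScaleCovariance

/-!
# Imbrie (2016), Assumption LLA: admissible box laws are dominated by Lebesgue measure on the unit cube

CITATION HEADER (lean-in-tree rule 2026-08-18). J. Z. Imbrie, *On many-body localization for quantum spin chains*,
J. Stat. Phys. **163** (2016) 998–1048, doi 10.1007/s10955-016-1508-x, arXiv:1403.7837 [ImbrieJSP2016], eq. (1.1) (model),
p. 1000 (admissible laws: independent `h_i, Γ_i, J_i` with bounded densities supported in `[-1, 1]`),
eq. (1.3) = (5.2) (Assumption LLA(ν, C)).

WHAT IS PROVED (a lemma of the audit cell `pub-imbrie`, NOT a statement of the paper). If every site/bond law is admissible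
with density bound `ρ₀` (`Laws.Admissible`), then the product law of the `3n+1` couplings of the box `[a, a+n-1]` satisfies
  `L.boxMeasure a n ≤ (ofReal ρ₀)^(3n+1) • (Lebesgue measure restricted to [-1,1]^n × [-1,1]^n × [-1,1]^(n+1))`
(`boxMeasure_le_smul_volume`), hence for EVERY event `S`:  `P(S) ≤ ρ₀^(3n+1) · Leb(S ∩ cube)` (`boxMeasure_apply_le`), and a
Lebesgue slab-volume bound `Leb({gap < δ} ∩ cube) ≤ V` becomes the LLA-shaped bound `P(gap < δ) ≤ ρ₀^(3n+1) V`
(`boxMeasure_smallGap_le_of_volume`). This is the bridge by which sub-level (slab) volume estimates — the form in which the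
cell proves its small-gap bounds (pub-imbrie LLA.md O2 (O2.1), (R3), block WE) — turn into statements about `Laws.boxMeasure`.

STATUS: measure theory only (monotonicity of finite products, `pi_le_pow_smul_pi` of ScaleCovariance); says NOTHING about
whether LLA holds — LLA for γ > 0 remains an OPEN, UNPROVED hypothesis of Thm 1.1. No `sorry`, no new axioms, no definitions
(the cube `[-1,1]^m` is written out as `Set.univ.pi fun _ : Fin m => Set.Icc (-1) 1`).
-/

noncomputable section
open _root_.MeasureTheory
open scoped ENNReal

namespace Literature.MathematicalPhysics.QuantumLattice.Imbrie2016

/-- an admissible law is dominated by `ρ₀ •` (Lebesgue measure restricted to `[-1, 1]`).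
[cite: ImbrieJSP2016, p. 1000 (admissible laws)] -/
theorem Admissible.le_smul_volume_restrict {ρ₀ : ℝ} {μ : Measure ℝ} (h : Admissible ρ₀ μ) :
    μ ≤ ENNReal.ofReal ρ₀ • (volume : Measure ℝ).restrict (Set.Icc (-1 : ℝ) 1) := h.2

/-- an admissible law is dominated by `ρ₀ •` Lebesgue measure. [cite: ImbrieJSP2016, p. 1000 (admissible laws)] -/
theorem Admissible.le_smul_volume {ρ₀ : ℝ} {μ : Measure ℝ} (h : Admissible ρ₀ μ) :
    μ ≤ ENNReal.ofReal ρ₀ • (volume : Measure ℝ) := by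
  refine h.2.trans ?_
  rw [Measure.le_iff']
  intro s
  simp only [Measure.smul_apply, smul_eq_mul]
  gcongr
  exact Measure.restrict_le_self

/-- the product of `m` admissible laws is dominated by `ρ₀^m •` (Lebesgue measure restricted to the cube `[-1,1]^m`).
[cite: ImbrieJSP2016, p. 1000 (admissible laws)] -/
theorem pi_admissible_le {ρ₀ : ℝ} {m : ℕ} (μ : Fin m → Measure ℝ) (h : ∀ i, Admissible ρ₀ (μ i)) :
    Measure.pi μ ≤ ENNReal.ofReal ρ₀ ^ m • (volume : Measure (Fin m → ℝ)).restrict (Set.univ.pi fun _ : Fin m => Set.Icc (-1 : ℝ) 1) := by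
  haveI : ∀ i, IsProbabilityMeasure (μ i) := fun i => (h i).1
  rw [volume_pi, Measure.restrict_pi_pi]
  exact pi_le_pow_smul_pi m (fun _ => (volume : Measure ℝ).restrict (Set.Icc (-1 : ℝ) 1)) μ
    (ENNReal.ofReal ρ₀) (fun i => (h i).2)

/-- **the box law is dominated by Lebesgue measure on the cube**: for admissible laws with density bound `ρ₀`,
`L.boxMeasure a n ≤ (ofReal ρ₀)^(3n+1) • Leb|_{[-1,1]^n × [-1,1]^n × [-1,1]^(n+1)}`.
Audit-cell lemma, not in the paper. [cite: ImbrieJSP2016, p. 1000 and eq. (1.3)] -/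
theorem boxMeasure_le_smul_volume {L : Laws} {ρ₀ : ℝ} (hL : L.Admissible ρ₀) (a : ℤ) (n : ℕ) :
    L.boxMeasure a n ≤ ENNReal.ofReal ρ₀ ^ (3 * n + 1) •
      (((volume : Measure (Fin n → ℝ)).restrict (Set.univ.pi fun _ : Fin n => Set.Icc (-1 : ℝ) 1)).prod
        (((volume : Measure (Fin n → ℝ)).restrict (Set.univ.pi fun _ : Fin n => Set.Icc (-1 : ℝ) 1)).prod
          ((volume : Measure (Fin (n + 1) → ℝ)).restrict (Set.univ.pi fun _ : Fin (n + 1) => Set.Icc (-1 : ℝ) 1)))) := by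
  have hA := pi_admissible_le (fun i : Fin n => L.μh (a + i)) (fun i => (hL _).1)
  have hB := pi_admissible_le (fun i : Fin n => L.μΓ (a + i)) (fun i => (hL _).2.1)
  have hD := pi_admissible_le (fun b : Fin (n + 1) => L.μJ (a + b - 1)) (fun b => (hL _).2.2)
  have key := Measure.prod_mono hA (Measure.prod_mono hB hD)
  rw [Measure.prod_smul_left, Measure.prod_smul_left, Measure.prod_smul_right, Measure.prod_smul_right,
    Measure.prod_smul_right, smul_smul, smul_smul, ← pow_add, ← pow_add] at key
  have e : n + n + (n + 1) = 3 * n + 1 := by ring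
  rw [e] at key
  exact key

/-- **every event**: `P(S) ≤ ρ₀^(3n+1) · Leb(S ∩ cube)` for admissible laws. Audit-cell lemma, not in the paper.
[cite: ImbrieJSP2016, p. 1000 and eq. (1.3)] -/
theorem boxMeasure_apply_le {L : Laws} {ρ₀ : ℝ} (hL : L.Admissible ρ₀) (a : ℤ) (n : ℕ)
    (S : Set ((Fin n → ℝ) × (Fin n → ℝ) × (Fin (n + 1) → ℝ))) :
    L.boxMeasure a n S ≤ ENNReal.ofReal ρ₀ ^ (3 * n + 1) *
      ((volume : Measure (Fin n → ℝ)).prod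
        ((volume : Measure (Fin n → ℝ)).prod (volume : Measure (Fin (n + 1) → ℝ))))
        (S ∩ (Set.univ.pi fun _ : Fin n => Set.Icc (-1 : ℝ) 1) ×ˢ ((Set.univ.pi fun _ : Fin n => Set.Icc (-1 : ℝ) 1) ×ˢ (Set.univ.pi fun _ : Fin (n + 1) => Set.Icc (-1 : ℝ) 1))) := by
  have h := Measure.le_iff'.1 (boxMeasure_le_smul_volume hL a n) S
  have hC : ∀ m : ℕ, MeasurableSet (Set.univ.pi fun _ : Fin m => Set.Icc (-1 : ℝ) 1) := fun m =>
    MeasurableSet.univ_pi fun _ => measurableSet_Icc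
  rw [Measure.smul_apply, smul_eq_mul, Measure.prod_restrict, Measure.prod_restrict,
    Measure.restrict_apply' ((hC n).prod ((hC n).prod (hC (n + 1))))] at h
  exact h

/-- **the bridge to the LLA shape**: a Lebesgue slab-volume bound for the small-gap event on the cube,
`Leb({gap < δ} ∩ cube) ≤ V`, gives `P(gap < δ) ≤ ρ₀^(3n+1) · V` for every family of admissible laws.
Audit-cell lemma, not in the paper; LLA itself is NOT asserted. [cite: ImbrieJSP2016, eq. (1.3)] -/
theorem boxMeasure_smallGap_le_of_volume {L : Laws} {ρ₀ : ℝ} (hL : L.Admissible ρ₀) (hρ : 0 ≤ ρ₀) (a : ℤ) (n : ℕ)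
    (γ δ V : ℝ)
    (hV : ((volume : Measure (Fin n → ℝ)).prod
        ((volume : Measure (Fin n → ℝ)).prod (volume : Measure (Fin (n + 1) → ℝ))))
        ({t | SmallGap γ δ (Params.ofTriple t)} ∩ (Set.univ.pi fun _ : Fin n => Set.Icc (-1 : ℝ) 1) ×ˢ ((Set.univ.pi fun _ : Fin n => Set.Icc (-1 : ℝ) 1) ×ˢ (Set.univ.pi fun _ : Fin (n + 1) => Set.Icc (-1 : ℝ) 1))) ≤ ENNReal.ofReal V) :
    L.boxMeasure a n {t | SmallGap γ δ (Params.ofTriple t)} ≤ ENNReal.ofReal (ρ₀ ^ (3 * n + 1) * V) := by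
  refine (boxMeasure_apply_le hL a n _).trans ?_
  rw [ENNReal.ofReal_mul (pow_nonneg hρ _), ENNReal.ofReal_pow hρ]
  gcongr

end Literature.MathematicalPhysics.QuantumLattice.Imbrie2016
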